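import Summits.HodgeConjecture.HodgeConjecture.Theorems.Ring2HypothesesFlatSectionsQP
import Summits.HodgeConjecture.HodgeConjecture.Theorems.AnchorTransportVariationalHodgeQuasiProjective
import Literature.AlgebraicGeometry.HodgeTheory.DirectImageBaseChangeSections
import Literature.AlgebraicGeometry.HodgeTheory.IsoTransport
import HarnessLib

/-!
# Ring 2 — hypotheses layer: the flat-section form of Conj. 11.3.1 is LOCAL ON THE BASE; `VHC ⟹` it for locally projective families, binder-free

HONEST FRAMING: research route conditional on HC_CM; not a corollary; Q11.4-sentence-2 already refuted in dim ≥ 3.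

Cell `pub-hodge-ring2`, seat `ring2-b04` (binder prover for row b04 of `BINDER-OWNERS.md`:
`Ring2.Hypotheses.FlatSectionsAlgebraic`, `Ring2Hypotheses.lean` §2). `HC_CM` plays no role in this file
and is not mentioned in any statement; nothing here proves a case of the Hodge conjecture. No
definition, no named fact.

## What this part adds

Part XXVII (`Ring2HypothesesFlatSectionsQP`) proved `VHC ⟹ FlatSectionsAlgebraicQP` — the global-class
form of the variational Hodge conjecture (item stmt-HodgeConjecture-1076, row b03) gives the flat-section
form of Charles–Schnell Conj. 11.3.1 ON THE PRINTED CARRIERS (`𝒳`, `S` quasi-projective), binder-free,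
through the tree theorem `deligne1968_invariantClass_fromTotalSpace_holds`. The node of row b04,
`FlatSectionsAlgebraic`, quantifies over ALL smooth irreducible bases and all smooth PROPER families
with projective fibres. This part proves that the flat-section statement is **local on the base** and
draws the binder-free consequence:

* `mem_locusOfHodgeClasses_iff_of_baseChange_eq`, `cls_mem_algebraicClasses_iff_of_baseChange_eq` —
  the data of Conj. 11.3.1 move along a pulled-back section (`FiberClass.baseChange π g k (σ' u) = σ (g u)`,
  the output of `FiberClass.exists_section_baseChange`).
* `flatSection_step_of_baseChange` — **transport of one instance along ANY base change
  `g : S' ⟶ S`** hitting the anchor and the target: if the flat-section statement holds for the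
  base-changed family `𝒳 ×_S S' ⟶ S'`, algebraicity passes from `σ(g t₀)` to `σ(g t)` (flat-section
  twin of `Theorems.variationalHodge_conclusion_of_baseChange`; the section is pulled back by
  `FiberClass.exists_section_baseChange_of_isSmoothProjectiveFamily`, Ehresmann over an ARBITRARY
  smooth base).
* `forall_complexPoints_of_openCover` — chains of opens from a prescribed open cover on an irreducible
  base (the affine case is `Theorems.forall_complexPoints_of_affineOpens`).
* `flatSection_algebraic_of_local` — **the flat-section statement for `f` holds as soon as it holds
  for the restrictions `f|_U` over the members `U` of an open cover of `S`.**
* `flatSection_algebraic_of_vhc_of_locallyQuasiProjective` — **BINDER-FREE: `VHC` (item 1076) gives the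
  flat-section form of Conj. 11.3.1 for every smooth projective family which is, locally on the base,
  carried by quasi-projective schemes** (`S` covered by opens `U` with `U` and `𝒳 ×_S U`
  quasi-projective) — over ANY smooth irreducible base, separated or not, quasi-compact or not. This
  class contains every family PROJECTIVE in Hartshorne's sense over any smooth irreducible base
  (`flatSection_algebraic_of_vhc_of_projective`) and every family with quasi-projective total space
  (seat ring2-b01's `flatSection_algebraic_of_vhc_of_isQuasiProjectiveOver`, not restated here).
* What is NOT covered — the exact residual of row b04: smooth proper families with projective fibres
  that are NOT locally projective over the base (they exist: mixed small resolutions of a two-nodal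
  quartic pencil, Atiyah 1958 — see `Theorems.variationalHodge_of_standardConjectureB_of_relProjective`).
  For those the bridge `VHC ⟹ FlatSectionsAlgebraic` needs the théorème de la partie fixe for PROPER
  smooth morphisms (Deligne 1971, Thm. 4.1.1 (i)), typed by seat ring2-b01 as the named fact
  `deligne1971_invariantClass_fromTotalSpace_proper`; nothing in this file depends on it.

Sources. F. Charles, C. Schnell, *Notes on absolute Hodge classes* [CharlesSchnell2014Notes] Conj.
11.3.1, Thm. 11.3.4, Prop. 11.3.5; C. Voisin, *Hodge Theory II* [VoisinHodgeII2003] §3.1.1 (inverse image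
of a local system), Thm. 4.18; A. Grothendieck 1966 [Grothendieck1966] footnote 13; R. Hartshorne
[Hartshorne1977] II §4 (projective morphisms).
-/

-- every declaration of this problem lives in `Summit.HodgeConjecture.HodgeConjecture.…` (summit = sub-problem)
set_option linter.dupNamespace false

noncomputable section

open CategoryTheory AlgebraicGeometry MonoidalCategory
open Literature.AlgebraicGeometry Literature.AlgebraicGeometry.Motives
open Literature.AlgebraicGeometry.HodgeTheory

namespace Summit.HodgeConjecture.HodgeConjecture.Ring2.Hypotheses

/-! ## §1 The data of Conj. 11.3.1 move along a pulled-back section -/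

section Transfer

variable {n p : ℕ} {𝒳 S S' : SchemeOver ℂ} (f : 𝒳 ⟶ S) (g : S' ⟶ S)

/-- Along a pulled-back section (`FiberClass.baseChange f g _ x' = x`), the value `x'` lies in the
locus of Hodge classes of the base-changed family iff `x` lies in that of `f` (rationality and Hodge
type transport along the fibre isomorphism `(𝒳 ×_S S')_{u} ≅ 𝒳_{g u}`, `isRationalClass_map_iff_of_iso`,
`isOfHodgeType_map_iff_of_iso`). [cite: CharlesSchnell2014Notes, Def. 11.3.9] -/
theorem mem_locusOfHodgeClasses_iff_of_baseChange_eq {x' : FiberClass (familyPullback.snd f g) (2 * p)}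
    {x : FiberClass f (2 * p)} (h : FiberClass.baseChange f g (2 * p) x' = x) :
    x' ∈ locusOfHodgeClasses (familyPullback.snd f g) n p ↔ x ∈ locusOfHodgeClasses f n p := by
  have h' : (⟨AlgPoints.map g x'.pt,
      complexBetti.map (fiberOverFamilyPullbackIso f g x'.pt).inv (2 * p) x'.cls⟩ : FiberClass f (2 * p)) =
      ⟨x.pt, x.cls⟩ := h
  rw [mem_locusOfHodgeClasses_iff, mem_locusOfHodgeClasses_iff,
    ← FiberClass.prop_iff_of_mk_eq
      (fun t c => IsRationalClass c ∧ IsOfHodgeType n (fiberOver f t) (2 * p) p p c) h']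
  exact (and_congr (isRationalClass_map_iff_of_iso (fiberOverFamilyPullbackIso f g x'.pt).symm)
    (isOfHodgeType_map_iff_of_iso (fiberOverFamilyPullbackIso f g x'.pt).symm)).symm

/-- Along a pulled-back section, the value `x'` is algebraic on its fibre iff `x` is
(`mem_algebraicClasses_map_iff_of_iso`). [cite: CharlesSchnell2014Notes, Conj. 11.3.1] -/
theorem cls_mem_algebraicClasses_iff_of_baseChange_eq {x' : FiberClass (familyPullback.snd f g) (2 * p)}
    {x : FiberClass f (2 * p)} (h : FiberClass.baseChange f g (2 * p) x' = x) :
    x'.cls ∈ algebraicClasses (fiberOver (familyPullback.snd f g) x'.pt) p ↔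
      x.cls ∈ algebraicClasses (fiberOver f x.pt) p := by
  have h' : (⟨AlgPoints.map g x'.pt,
      complexBetti.map (fiberOverFamilyPullbackIso f g x'.pt).inv (2 * p) x'.cls⟩ : FiberClass f (2 * p)) =
      ⟨x.pt, x.cls⟩ := h
  rw [← FiberClass.prop_iff_of_mk_eq (fun t c => c ∈ algebraicClasses (fiberOver f t) p) h']
  exact (mem_algebraicClasses_map_iff_of_iso (fiberOverFamilyPullbackIso f g x'.pt).symm).symm

/-- **Transport of one instance of the flat-section statement along ANY base change hitting anchor
and target.** Let `f : 𝒳 ⟶ S` be a smooth projective family over a smooth `S`, `σ` a continuous section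
of the espace étalé of `R²ᵖf_*ℂ` valued in the locus of Hodge classes, and `g : S' ⟶ S` any morphism
of `ℂ`-schemes. If the flat-section statement holds for the base-changed family `𝒳 ×_S S' ⟶ S'` (for
all its continuous Hodge-valued sections), then algebraicity of `σ` passes from `g t₀` to `g t`: pull
`σ` back along `g` (`FiberClass.exists_section_baseChange_of_isSmoothProjectiveFamily` — Ehresmann over
an arbitrary smooth base), move the Hodge-locus hypothesis and the anchor across, apply the statement
upstairs, move the conclusion back. The flat-section twin of
`Theorems.variationalHodge_conclusion_of_baseChange`. [cite: VoisinHodgeII2003, §3.1.1 (p. 69)]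
[cite: CharlesSchnell2014Notes, Conj. 11.3.1] -/
theorem flatSection_step_of_baseChange (hf : IsSmoothProjectiveFamily f n) [AlgebraicGeometry.Smooth S.hom]
    {σ : ComplexPoints S → FiberClass f (2 * p)} (hσ : Continuous σ) (hpt : ∀ s, (σ s).pt = s)
    (hH : ∀ s, σ s ∈ locusOfHodgeClasses f n p)
    (h : ∀ (τ : ComplexPoints S' → FiberClass (familyPullback.snd f g) (2 * p)),
      Continuous τ → (∀ u, (τ u).pt = u) →
      (∀ u, τ u ∈ locusOfHodgeClasses (familyPullback.snd f g) n p) →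
      (∃ u₀, (τ u₀).cls ∈ algebraicClasses (fiberOver (familyPullback.snd f g) (τ u₀).pt) p) →
      ∀ u, (τ u).cls ∈ algebraicClasses (fiberOver (familyPullback.snd f g) (τ u).pt) p)
    {t₀ : ComplexPoints S'}
    (h₀ : (σ (AlgPoints.map g t₀)).cls ∈ algebraicClasses (fiberOver f (σ (AlgPoints.map g t₀)).pt) p)
    (t : ComplexPoints S') :
    (σ (AlgPoints.map g t)).cls ∈ algebraicClasses (fiberOver f (σ (AlgPoints.map g t)).pt) p := by
  obtain ⟨σ', hσ', hpt', hbc⟩ :=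
    FiberClass.exists_section_baseChange_of_isSmoothProjectiveFamily f g (2 * p) hf hσ hpt
  exact (cls_mem_algebraicClasses_iff_of_baseChange_eq f g (hbc t)).1
    (h σ' hσ' hpt' (fun u => (mem_locusOfHodgeClasses_iff_of_baseChange_eq f g (hbc u)).2 (hH _))
      ⟨t₀, (cls_mem_algebraicClasses_iff_of_baseChange_eq f g (hbc t₀)).2 h₀⟩ t)

end Transfer

/-! ## §2 The flat-section statement is local on the base -/

/-- **Propagation along a prescribed open cover.** On an irreducible `ℂ`-scheme locally of finite type,
a property `P` of complex points which passes from `a` to `b` whenever `pt a`, `pt b` lie in a common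
member of an open cover `x ↦ 𝒰 x ∋ x` passes from any `s₀` to any `s`: `𝒰 (pt s₀)` and `𝒰 (pt s)` meet
(irreducibility) in an open containing a closed point (Jacobson), which underlies a complex point
(`EsnaultLevineViehweg.exists_algPoints_pt_eq`); go `s₀ → u → s`. (The affine-cover case is
`Theorems.forall_complexPoints_of_affineOpens`.) [folklore] -/
theorem forall_complexPoints_of_openCover {S : SchemeOver ℂ} [IrreducibleSpace S.left]
    [LocallyOfFiniteType S.hom] (P : ComplexPoints S → Prop) (𝒰 : S.left → S.left.Opens)
    (h𝒰 : ∀ x, x ∈ 𝒰 x)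
    (step : ∀ x : S.left, ∀ a b : ComplexPoints S, a.pt ∈ 𝒰 x → b.pt ∈ 𝒰 x → P a → P b)
    {s₀ : ComplexPoints S} (h₀ : P s₀) (s : ComplexPoints S) : P s := by
  haveI : JacobsonSpace S.left := LocallyOfFiniteType.jacobsonSpace S.hom
  have hne : ((𝒰 s₀.pt : Set S.left) ∩ (𝒰 s.pt : Set S.left)).Nonempty := by
    obtain ⟨x, -, hx⟩ := (PreirreducibleSpace.isPreirreducible_univ (X := S.left)) _ _ (𝒰 s₀.pt).isOpen
      (𝒰 s.pt).isOpen ⟨s₀.pt, Set.mem_univ _, h𝒰 _⟩ ⟨s.pt, Set.mem_univ _, h𝒰 _⟩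
    exact ⟨x, hx⟩
  obtain ⟨y, ⟨hy₀, hy⟩, hyc⟩ :=
    nonempty_inter_closedPoints hne ((𝒰 s₀.pt).isOpen.inter (𝒰 s.pt).isOpen).isLocallyClosed
  obtain ⟨u, rfl⟩ := EsnaultLevineViehweg.exists_algPoints_pt_eq (X := S) (k := ℂ) hyc
  exact step s.pt u s hy (h𝒰 _) (step s₀.pt s₀ u (h𝒰 _) hy₀ h₀)

section Local

variable {n p : ℕ} {𝒳 S : SchemeOver ℂ} (f : 𝒳 ⟶ S)

/-- **One step inside an open of the base.** If the flat-section statement holds for the restriction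
`𝒳 ×_S U ⟶ U` of a smooth projective family `f` (over a smooth `S`) to an open `U ⊆ S`, then for every
continuous Hodge-valued section `σ` of the espace étalé of `R²ᵖf_*ℂ` algebraicity passes between any two
complex points of `U` (lift them to `U`, `AlgPoints.range_map_of_isOpenImmersion_holds`, and transport
along the base change `U ⟶ S`, `flatSection_step_of_baseChange`). [cite: CharlesSchnell2014Notes, Conj. 11.3.1] -/
theorem flatSection_step_of_open (hf : IsSmoothProjectiveFamily f n) [AlgebraicGeometry.Smooth S.hom]
    {σ : ComplexPoints S → FiberClass f (2 * p)} (hσ : Continuous σ) (hpt : ∀ s, (σ s).pt = s)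
    (hH : ∀ s, σ s ∈ locusOfHodgeClasses f n p) (U : S.left.Opens)
    (h : ∀ (τ : ComplexPoints (openSubschemeOver S U) →
        FiberClass (familyPullback.snd f (openSubschemeOverι S U)) (2 * p)),
      Continuous τ → (∀ u, (τ u).pt = u) →
      (∀ u, τ u ∈ locusOfHodgeClasses (familyPullback.snd f (openSubschemeOverι S U)) n p) →
      (∃ u₀, (τ u₀).cls ∈
        algebraicClasses (fiberOver (familyPullback.snd f (openSubschemeOverι S U)) (τ u₀).pt) p) →
      ∀ u, (τ u).cls ∈
        algebraicClasses (fiberOver (familyPullback.snd f (openSubschemeOverι S U)) (τ u).pt) p)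
    (a b : ComplexPoints S) (haU : a.pt ∈ U) (hbU : b.pt ∈ U)
    (ha : (σ a).cls ∈ algebraicClasses (fiberOver f (σ a).pt) p) :
    (σ b).cls ∈ algebraicClasses (fiberOver f (σ b).pt) p := by
  haveI : IsOpenImmersion (openSubschemeOverι S U).left := inferInstanceAs (IsOpenImmersion U.ι)
  have hrange : Set.range (AlgPoints.map (L := ℂ) (openSubschemeOverι S U)) = {P | P.pt ∈ U} := by
    rw [AlgPoints.range_map_of_isOpenImmersion_holds]
    ext P
    change P.pt ∈ U.ι.opensRange ↔ P.pt ∈ U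
    rw [Scheme.Opens.opensRange_ι]
  obtain ⟨a', rfl⟩ : a ∈ Set.range (AlgPoints.map (L := ℂ) (openSubschemeOverι S U)) := by
    rw [hrange]; exact haU
  obtain ⟨b', rfl⟩ : b ∈ Set.range (AlgPoints.map (L := ℂ) (openSubschemeOverι S U)) := by
    rw [hrange]; exact hbU
  exact flatSection_step_of_baseChange f (openSubschemeOverι S U) hf hσ hpt hH h ha b'

/-- **The flat-section form of Conj. 11.3.1 is local on the base.** Let `f : 𝒳 ⟶ S` be a smooth
projective family over a smooth irreducible `S`, and `x ↦ 𝒰 x ∋ x` an open cover of `S` such that the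
flat-section statement holds for every restriction `𝒳 ×_S 𝒰 x ⟶ 𝒰 x`. Then it holds for `f`: a
continuous section of the espace étalé of `R²ᵖf_*ℂ` valued in the locus of Hodge classes and algebraic
at one point is algebraic at every point (`forall_complexPoints_of_openCover` + `flatSection_step_of_open`).
Neither separatedness nor quasi-compactness of `S` is needed. [cite: CharlesSchnell2014Notes, Conj. 11.3.1]
[cite: VoisinHodgeII2003, §3.1.1 (p. 69)] -/
theorem flatSection_algebraic_of_local (hf : IsSmoothProjectiveFamily f n) [IrreducibleSpace S.left]
    [AlgebraicGeometry.Smooth S.hom] (𝒰 : S.left → S.left.Opens) (h𝒰 : ∀ x, x ∈ 𝒰 x)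
    (h : ∀ x : S.left, ∀ (τ : ComplexPoints (openSubschemeOver S (𝒰 x)) →
        FiberClass (familyPullback.snd f (openSubschemeOverι S (𝒰 x))) (2 * p)),
      Continuous τ → (∀ u, (τ u).pt = u) →
      (∀ u, τ u ∈ locusOfHodgeClasses (familyPullback.snd f (openSubschemeOverι S (𝒰 x))) n p) →
      (∃ u₀, (τ u₀).cls ∈
        algebraicClasses (fiberOver (familyPullback.snd f (openSubschemeOverι S (𝒰 x))) (τ u₀).pt) p) →
      ∀ u, (τ u).cls ∈
        algebraicClasses (fiberOver (familyPullback.snd f (openSubschemeOverι S (𝒰 x))) (τ u).pt) p)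
    {σ : ComplexPoints S → FiberClass f (2 * p)} (hσ : Continuous σ) (hpt : ∀ s, (σ s).pt = s)
    (hH : ∀ s, σ s ∈ locusOfHodgeClasses f n p)
    (h₀ : ∃ s₀, (σ s₀).cls ∈ algebraicClasses (fiberOver f (σ s₀).pt) p) (s : ComplexPoints S) :
    (σ s).cls ∈ algebraicClasses (fiberOver f (σ s).pt) p := by
  obtain ⟨s₀, hs₀⟩ := h₀
  haveI : LocallyOfFiniteType S.hom := inferInstance
  exact forall_complexPoints_of_openCover (fun t => (σ t).cls ∈ algebraicClasses (fiberOver f (σ t).pt) p)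
    𝒰 h𝒰 (fun x a b haU hbU ha => flatSection_step_of_open f hf hσ hpt hH (𝒰 x) (h x) a b haU hbU ha)
    hs₀ s

end Local

/-! ## §3 `VHC ⟹` the flat-section form for locally projective families (binder-free) -/

section VHC

variable {n : ℕ} {𝒳 S : SchemeOver ℂ} (f : 𝒳 ⟶ S)

/-- An open subscheme of an irreducible scheme containing a point is irreducible. [folklore] -/
theorem irreducibleSpace_openSubschemeOver [IrreducibleSpace S.left] (U : S.left.Opens) {x : S.left}
    (hx : x ∈ U) : IrreducibleSpace (openSubschemeOver S U).left := by
  change IrreducibleSpace U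
  exact isIrreducible_iff_irreducibleSpace.mp ⟨⟨x, hx⟩,
    (PreirreducibleSpace.isPreirreducible_univ (X := S.left)).open_subset U.isOpen (Set.subset_univ _)⟩

/-- **BINDER-FREE: `VHC` (item stmt-HodgeConjecture-1076) gives the flat-section form of Conj. 11.3.1
for every smooth projective family that is, locally on the base, carried by quasi-projective schemes**
— over ANY smooth irreducible base. Hypothesis: every point of `S` has an open neighbourhood `U` with
`U` and `𝒳 ×_S U` quasi-projective over `ℂ` (e.g. `f` projective in Hartshorne's sense, or `𝒳`
quasi-projective). Proof: the statement is local on the base (`flatSection_algebraic_of_local`), and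
over such a `U` (irreducible as a non-empty open of `S`, smooth over `ℂ`) part XXVII's
`flatSectionsAlgebraicQP_of_vhc` applies to the restricted family (`IsSmoothProjectiveFamily.familyPullback_snd`).
No named fact: Deligne 1968 enters through the tree THEOREM `deligne1968_invariantClass_fromTotalSpace_holds`
(inside part XXVII), Ehresmann through `isCohomologicallyLocallyTrivialOn_univ_of_isSmoothProjectiveFamily_of_smooth`.
[cite: CharlesSchnell2014Notes, Conj. 11.3.1, Thm. 11.3.4 and proof of Prop. 11.3.5]
[cite: VoisinHodgeII2003, Thm. 4.18 and §3.1.1] -/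
theorem flatSection_algebraic_of_vhc_of_locallyQuasiProjective (hV : Theses.AnchorTransport.VariationalHodge)
    (hf : IsSmoothProjectiveFamily f n) [IrreducibleSpace S.left] [AlgebraicGeometry.Smooth S.hom]
    (hloc : ∀ x : S.left, ∃ U : S.left.Opens, x ∈ U ∧ IsQuasiProjectiveOver (openSubschemeOver S U) ∧
      IsQuasiProjectiveOver (familyPullback f (openSubschemeOverι S U)))
    (p : ℕ) {σ : ComplexPoints S → FiberClass f (2 * p)} (hσ : Continuous σ) (hpt : ∀ s, (σ s).pt = s)
    (hH : ∀ s, σ s ∈ locusOfHodgeClasses f n p)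
    (h₀ : ∃ s₀, (σ s₀).cls ∈ algebraicClasses (fiberOver f (σ s₀).pt) p) (s : ComplexPoints S) :
    (σ s).cls ∈ algebraicClasses (fiberOver f (σ s).pt) p := by
  choose 𝒰 h𝒰 hU𝒰 hX𝒰 using hloc
  refine flatSection_algebraic_of_local f hf 𝒰 h𝒰 (fun x τ hτ hptτ hHτ h₀τ u => ?_) hσ hpt hH h₀ s
  haveI : IsOpenImmersion (openSubschemeOverι S (𝒰 x)).left := inferInstanceAs (IsOpenImmersion (𝒰 x).ι)
  have hsm : AlgebraicGeometry.Smooth (openSubschemeOver S (𝒰 x)).hom := by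
    change AlgebraicGeometry.Smooth ((𝒰 x).ι ≫ S.hom)
    infer_instance
  exact flatSectionsAlgebraicQP_of_vhc hV (familyPullback.snd f (openSubschemeOverι S (𝒰 x)))
    (hf.familyPullback_snd _) (hX𝒰 x) (hU𝒰 x) (irreducibleSpace_openSubschemeOver (𝒰 x) (h𝒰 x)) hsm p
    τ hτ hptτ hHτ h₀τ u

/-- **BINDER-FREE: `VHC` gives the flat-section form of Conj. 11.3.1 for every smooth family PROJECTIVE
in Hartshorne's sense** (`f` = a closed immersion `𝒳 ⟶ ℙᴺ × S` followed by the projection — the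
"smooth projective morphism" of the printed conjecture) **over ANY smooth irreducible base** `S`
(separated or not, quasi-compact or not, NOT assumed quasi-projective): around each point take an
affine open `U` — quasi-projective, `IsQuasiProjectiveOver.of_isAffine` — over which `𝒳 ×_S U ↪ ℙᴺ × U`
is closed (`Motives.exists_isClosedImmersion_familyPullback`), so `𝒳 ×_S U` is quasi-projective
(`Theorems.isQuasiProjectiveOver_of_isClosedImmersion_of_isAffine`). Part XXVII had this only for `S`
(and `𝒳`) quasi-projective. [cite: CharlesSchnell2014Notes, Conj. 11.3.1 and proof of Prop. 11.3.5]
[cite: Hartshorne1977, Ch. II §4 p. 103] -/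
theorem flatSection_algebraic_of_vhc_of_projective (hV : Theses.AnchorTransport.VariationalHodge)
    (hf : IsSmoothProjectiveFamily f n) [IrreducibleSpace S.left] [AlgebraicGeometry.Smooth S.hom]
    (hι : ∃ (N : ℕ) (ι : 𝒳 ⟶ projectiveSpace N ℂ ⊗ S), IsClosedImmersion ι.left ∧
      ι ≫ CartesianMonoidalCategory.snd (projectiveSpace N ℂ) S = f)
    (p : ℕ) {σ : ComplexPoints S → FiberClass f (2 * p)} (hσ : Continuous σ) (hpt : ∀ s, (σ s).pt = s)
    (hH : ∀ s, σ s ∈ locusOfHodgeClasses f n p)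
    (h₀ : ∃ s₀, (σ s₀).cls ∈ algebraicClasses (fiberOver f (σ s₀).pt) p) (s : ComplexPoints S) :
    (σ s).cls ∈ algebraicClasses (fiberOver f (σ s).pt) p := by
  refine flatSection_algebraic_of_vhc_of_locallyQuasiProjective f hV hf (fun x => ?_) p hσ hpt hH h₀ s
  obtain ⟨U, hU, hxU, -⟩ := exists_isAffineOpen_mem_and_subset (U := ⊤) (x := x) trivial
  haveI : IsOpenImmersion (openSubschemeOverι S U).left := inferInstanceAs (IsOpenImmersion U.ι)
  haveI : IsAffine (openSubschemeOver S U).left := hU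
  haveI : AlgebraicGeometry.Smooth (openSubschemeOver S U).hom := by
    change AlgebraicGeometry.Smooth (U.ι ≫ S.hom)
    infer_instance
  haveI : LocallyOfFiniteType (openSubschemeOver S U).hom := inferInstance
  exact ⟨U, hxU, IsQuasiProjectiveOver.of_isAffine _,
    Theorems.isQuasiProjectiveOver_of_isClosedImmersion_of_isAffine
      (f := familyPullback.snd f (openSubschemeOverι S U))
      (exists_isClosedImmersion_familyPullback f (openSubschemeOverι S U) hι)⟩

/-- **`VHC ⟹ FlatSectionsAlgebraic` restricted to locally quasi-projective families, stated at the
level of the nodes** (all `n`, all bases): the residual of row b04 is exactly the class of smooth proper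
families with projective fibres that are not locally projective over their base.
[cite: CharlesSchnell2014Notes, Conj. 11.3.1] -/
theorem flatSections_locallyQuasiProjective_of_vhc (hV : Theses.AnchorTransport.VariationalHodge) :
    ∀ ⦃n : ℕ⦄ ⦃𝒳 S : SchemeOver ℂ⦄ (f : 𝒳 ⟶ S), IsSmoothProjectiveFamily f n → IrreducibleSpace S.left →
      AlgebraicGeometry.Smooth S.hom →
      (∀ x : S.left, ∃ U : S.left.Opens, x ∈ U ∧ IsQuasiProjectiveOver (openSubschemeOver S U) ∧
        IsQuasiProjectiveOver (familyPullback f (openSubschemeOverι S U))) →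
      ∀ (p : ℕ) (σ : ComplexPoints S → FiberClass f (2 * p)),
      Continuous σ → (∀ s, (σ s).pt = s) → (∀ s, σ s ∈ locusOfHodgeClasses f n p) →
      (∃ s₀, (σ s₀).cls ∈ algebraicClasses (fiberOver f (σ s₀).pt) p) →
      ∀ s, (σ s).cls ∈ algebraicClasses (fiberOver f (σ s).pt) p :=
  fun _ _ _ f hf hirr hsm hloc p _ hσ hpt hH h₀ s =>
    haveI := hirr
    haveI := hsm
    flatSection_algebraic_of_vhc_of_locallyQuasiProjective f hV hf hloc p hσ hpt hH h₀ s

end VHC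

/-! ## Audit

No definition, no named fact, no `sorry`; `HC_CM` does not occur. The only non-trivial inputs are tree
THEOREMS: part XXVII's `flatSectionsAlgebraicQP_of_vhc` (Deligne 1968 discharged), Ehresmann over an
arbitrary smooth base and the pull-back of flat sections (`Literature/…/DirectImageBaseChangeSections`).
Axiom closures: the three standard axioms only. -/

#print axioms Summit.HodgeConjecture.HodgeConjecture.Ring2.Hypotheses.flatSection_algebraic_of_local
#print axioms Summit.HodgeConjecture.HodgeConjecture.Ring2.Hypotheses.flatSection_algebraic_of_vhc_of_projective

end Summit.HodgeConjecture.HodgeConjecture.Ring2.Hypotheses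

end
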